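import Mathlib
import HarnessLib
import HarnessLib.Audit
import Summits.QuantumAdvantage.Statement
import HarnessLib.Audit.Status.Attr

/-!
Route: KummerSector

DORMANT since 2026-08-26T14:17:17Z (reconciler: no traction for 6.7 d (last activity item-proof-filed at 2026-08-19T20:56:38Z); parked, not closed — `ledger route dormant route-QuantumAdvantage-KummerSector --off` to reactivate) — unstaffed, not closed; items shared with open routes are served there. `ledger route dormant <id> --off` reactivates.

Thesis X (realises idea card QuantumAdvantage/QuantumAdvantage/kummer-sector-language). Words:
KUMMER'S CLASS-I LANGUAGE is not in BPP, where KS := { p : p prime, p ≡ 1 (mod 3), G_p > √p }, G_p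
:= Σ_{x mod p} e(x³/p) = Σ_{x<p} cos(2πx³/p) ∈ ℝ. By IrelandRosen1990 §9.12 (pp. 137–138 of the held
1982 ed.), G_p = g(χ)+conj g(χ) = 2 Re g(χ) for either cubic character χ mod p, it is the real root
of x³ − 3px − Ap (4p = A²+27B², A ≡ 1 (3)) and lies in exactly one of (√p,2√p), (−√p,√p), (−2√p,−√p)
— Kummer's classes I, II, III, the trit of p; since g(χ)³ = p·J(χ,χ) = pπ (IR §9.4 Lemma 1 + Cor.,
p. 123), "G_p > √p" says that g(χ) is the PRINCIPAL cube root of pπ — Kummer's (1846) class I, whose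
per-prime determination is Kummer's problem. Equality G_p = ±√p is impossible.
Lean (one line over existing declarations; `lean check` rc 0 in Sketch.lean):
  Computability.encodingNatBool.toLanguage {p : ℕ | p.Prime ∧ p % 3 = 1 ∧ Real.sqrt (p:ℝ) < ∑ x ∈
Finset.range p, Real.cos (2 * Real.pi * (x:ℝ) ^ 3 / (p:ℝ))} ∉
Literature.Computability.Complexity.BPP
It suffices to show X: KS ∈ BQP (crux KsMemBQP — the algebraic quantisation g³ = pπ turns van
Dam–Seroussi's O(1)-precision phase estimate of arg g(χ) [vanDamSeroussi2002 Thm 1] into an EXACT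
decision among three candidates 2π/3 apart, the candidates being classical via π = J(χ,χ) (Euclid in
ℤ[ω]) and √−3 mod p (Schoof1985, deterministic)), and then ⟨KS, KsMemBQP, X⟩ witnesses ∃ L ∈ BQP, L
∉ BPP = QuantumAdvantage (item Assembly, one line: `KsMemBQP → KsThesis → QuantumAdvantage`, proved
in the sketch by `fun h1 h2 => ⟨_, h1, h2⟩`).
THE BRIDGE AND ITS CONDITION. X is hypothesis-type, and the route is a CONDITIONAL BRIDGE whose
declared condition `vanDamSeroussi2002` is, since the route-choice repair of 2026-08-16, a LISTED
CRUX of exactly that name: van Dam–Seroussi 2002 §8 (arXiv:quant-ph/0207131 p. 12: "it remains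
therefore an important open question if Gauss sum estimation is hard classically, even under the
assumption that factoring and discrete logarithms are easy") in the cubic prime-field case, where
constant-precision estimation of arg g(χ) IS Kummer's trit — formally W: NOT all three class
languages L_I = KS, L_II = {p : −√p < G_p < √p}, L_III = {p : G_p < −√p} are in BPP ("Kummer's trit
is not BPP-computable"; input p alone, so no primitive-root/factoring/DLOG side door — vDS's proviso
is built in). W is strictly WEAKER than X (X → W, h ↦ h.1), and the deciding theorem closes from W:
`closes (h₁ : KsMemBQP) (h₂ : KsLowerClassesMemBQP) (h₃ : vanDamSeroussi2002) : QuantumAdvantage`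
(classes II and III are in BQP by the same phase estimation, support item KsLowerClassesMemBQP; pure
logic: if BQP ⊆ BPP, all three class languages are in BPP, contradicting W). No reduction of W or X
from any standard assumption is known or claimed (vDS §5.1 Lemma 2, DLOG ≤ estimation, needs a
FULL-order character and says nothing about the cubic sector). The negation ¬X is filed and staffed
(KsClassical); X itself (KsThesis) is the route's target statement, sufficient via X → W.

CONDITIONAL on vanDamSeroussi2002 — this route is an explicit reduction to that named conjecture (D-0019: crux floor waived).

Rationale: WHY THIS LINE. Every witness route to S is conditional; the explicit candidates for BQP∖BPP in print
(factoring, DLOG, Pell/unit groups, abelian HSP) form ONE family: quantisation by integrality of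
periods. This line imports algebraic number theory (cubic reciprocity, Stickelberger:
IrelandRosen1990 Ch. 8–9) to add a candidate outside it: quantisation by the ALGEBRAIC identity
g(χ)³ = p·J(χ,χ), so that an archimedean angle read by phase estimation to ±π/6 (vanDamSeroussi2002
Thm 1; tree fact
Literature.Computability.Cryptography.VanDamSeroussi2002_cubicGaussSumPhase_qsolvable, t = 12)
decides a promise-free TOTAL language whose classical determination is Kummer's problem (1846): 180
years produced the Cassels1970/Matthews1979 elliptic-function formula with (p−1)/3 factors,
equidistribution (HeathBrownPatterson1979, Patterson1987) and the bias law (DunnRadziwill2024), but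
no algorithm polynomial in log p. Dictionary "finite places classical / infinite place quantum":
cubic residue symbols (reciprocity = Euclid-type descent), J(χ,χ) = π (Cornacchia/Euclid in ℤ[ω])
and the 𝔓-adic digits of g (Stickelberger, Gross–Koblitz, at Gauss-factorial cost,
CosgraveDilcher2011) are classical; ℚ(ω) is totally complex, so no product formula ties the complex
sector of g to finite-place data — the structural bet behind X, made theorem-type in crux 3.
Calibration: for the QUARTIC Gauss sum Matthews' formula is elementary, ε = −β·χ_π(2i)·(2|b|/a) with
β = ((p−1)/2)! mod π (IR p. 138), and Gauss factorials are governed by class numbers/units of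
quadratic fields (Mordell, Chowla; CosgraveDilcher2011) — Hallgren-computable quantumly,
subexponential classically: that is what a classical handle on the cubic trit would look like if one
existed (crux 4). Pseudo-deterministic framing: AaronsonGurLi2026 (query model); here white-box, so
their quintic limit is void. THE DECIDING THEOREM (since the route-choice repair (a) of 2026-08-16):
`closes (h₁ : KsMemBQP) (h₂ : KsLowerClassesMemBQP) (h₃ : vanDamSeroussi2002) : QuantumAdvantage` —
pure logic (if BQP ⊆ BPP, Kummer's three class languages, placed in BQP by h₁ and h₂, are all in
BPP, which h₃ denies); earned content = KsMemBQP + KsLowerClassesMemBQP (one phase-estimation lemma,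
three acceptance windows); the hypothesis-type end is the LISTED CRUX `vanDamSeroussi2002` = the
route's declared conditional_on, by name (D-0027 §2.2) = vDS §8 (p. 12) in the cubic prime-field
case = "Kummer's trit is not BPP-computable" (W), strictly weaker than the thesis X = KsThesis (X →
W: h ↦ h.1), which stays as the route's target statement; the earlier two-hypothesis form survives
as the provable item Assembly (`KsMemBQP → KsThesis → QuantumAdvantage`, ⟨_, h₁, h₂⟩).
RANKED CRUXES. (decls of Theses/KummerSector.lean; each docstring carries why-it-might-fail +
sources)
 #2 KsMemBQP — KS = L_I ∈ BQP in the tree's P-uniform Clifford+T model — the needed fact; new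
infrastructure = uniform approximate finite Fourier transform F_p (Kitaev1995 §5 /
HalesHallgren2000); reuses the Shor chain (Kitaev Hadamard tests, isQSolvable_classicalWrap_holds,
BQP subroutines) and the vendored vDS fact (why it might fail: safe mathematically, may fail AS
TYPED — approximate QFT_p with proved operator-norm error is absent).
 #3 KsNotFrobenianR — REPAIRED 2026-08-15 (stmt-QuantumAdvantage-10865): for every modulus m ≥ 1 and
every finite list of NONZERO f_i ∈ ℤ[X], Kummer's class I is not eventually a function of (p mod m,
#roots of f_i mod p): no CRT / Chebotarev-table algorithm (the Schoof–Edixhoven–Couveignes paradigm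
for ALGEBRAIC automorphic coefficients) decides KS; expected from first-moment bounds for g̃ over
primes in Chebotarev classes, i.e. twists by Hecke and permutation characters over the intermediate
fields of a Galois K/ℚ(ω) (Patterson1987); "Kummer's trit is not Frobenian" (Serre2012NXp §3.3)
seems unrecorded (why it might fail: open theorem-type claim far from Mathlib; even m = 1, fs = []
needs HeathBrownPatterson1979). Its predecessor KsNotFrobenian (stmt-1615, all lists fs) is
REFUTED-MISSTATED by Theorems.KummerSectorKsNotFrobenian_refuted (fs = [0]: the zero polynomial's
"root count" is p itself, so the datum determines p) — a settled negative edge with no algorithmic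
content, dropped from the route.
 #4 KsClassical — ¬X: KS ∈ BPP — the kill, = a negative answer to vanDamSeroussi2002 §8 for the
cubic sector. Most plausible path: a Chowla–Mordell-type evaluation of Matthews' third-set product
by unit/class data of ℚ(ω,∛(pπ)) + Buchmann — still only subexponential; or a cubic analogue of
theta-reciprocity descent (Hiary2011 is quadratic-only: cubic sums are Fourier-self-dual at the same
modulus).
 #5 vanDamSeroussi2002 — THE BRIDGE CONDITION, listed under the route's conditional_on name
(route-choice repair (a) after the operator hold bridge-only of 2026-08-16): W = ¬(L_I ∈ BPP ∧ L_II
∈ BPP ∧ L_III ∈ BPP) for Kummer's three class languages L_I = KS = {G_p > √p}, L_II = {−√p < G_p <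
√p}, L_III = {G_p < −√p} (p ≡ 1 (3) prime, G_p = Σ_{x<p} cos(2πx³/p); input p alone, so no
primitive-root/DLOG side door) — "Kummer's trit is not BPP-computable" = vDS §8 p. 12 ("important
open question if Gauss sum estimation is hard classically, even under the assumption that factoring
and discrete logarithms are easy") in the cubic prime-field case, where constant-precision
estimation of arg g(χ) IS the trit (g³ = pπ). Hypothesis-type / open problem, read it as the LAST
crux for staffing: a seat handed it answers verdict: open-problem (with the three class languages in
BQP ⊆ PSPACE, W ⇒ P ≠ PSPACE: Literature.Barriers.QuantumAdvantage.SeparationPrerequisites);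
refuters vet its USE; it is attacked through #4 and the cheap falsifier of #3 (why it might fail: no
reduction from any standard assumption — vDS Lemma 2 needs a full-order χ — and it may simply be
false: a Chowla–Matthews-type unit/class-number formula for the cubic Gauss sum or a cubic
reciprocity descent would compute the trit in subexp or P).
 #6 KsLowerClassesMemBQP (rank 9: served after #2) — L_II ∈ BQP ∧ L_III ∈ BQP, LOAD-BEARING in
closes (crux-only deciding theorem, D-0027 §2.1): the same van Dam–Seroussi phase estimation as #2
with the other two acceptance windows; the class is read off (sector k, sign arg π): class I ⇔ k =
0; k = 1: II ⇔ arg π < 0; k = 2: II ⇔ arg π > 0; expected to fall with #2 (why it might fail: as #2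
— safe mathematically, may fail AS TYPED).
 #0 KsThesis — X itself: KS ∉ BPP, the route's TARGET statement (target at open, crux by the rev-6
re-badge, target again since the route-choice repair of 2026-08-16, now that the open end of the
bridge is the listed crux #5): X → W trivially, so X still suffices (Assembly); hypothesis-type,
same status and same attacks as #5; not separately staffed.
 #1 Assembly · support: KsEquidistributed (density 1/3 in every infinite Frobenian cell — the form
the analytic proof gives; implies KsNotFrobenianR by pigeonhole), KsCertificate (KS ∈ NP ∩ coNP? —
certificate face of retired card kummer-three-faces), KsEllLadder (largest-Gaussian-period language
∈ BQP for every prime ℓ; ℓ = 2 is Gauss's sign theorem = Frobenian = P, ℓ = 3 is KS).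
KILL CRITERIA. KsClassical proved ⇒ X is false ⇒ close refuted:KsThesis (formally W survives only if
classes II/III resisted while class I is classical — not credible, every classical handle in sight
computes the whole trit; the tenure planner closes rather than retreats to W). ¬W proved outright
(all three class languages in BPP, e.g. a polynomial trit algorithm) ⇒ close
refuted:vanDamSeroussi2002. KsNotFrobenianR refuted by a GENUINE table (m, nonzero f_i, D, N) ⇒ KS ∈
P outright (p mod m and #roots = deg gcd(f_i, x^p − x) over F_p are deterministic poly(log p); the
datum takes finitely many values for p ≥ N), and the same table method run on L_II gives the trit ⇒
X and W false ⇒ close refuted:KsThesis; refuted by another DEGENERATE instance (as fs ∋ 0 was) ⇒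
misstatement, repair the side condition, not a kill. KsMemBQP / KsLowerClassesMemBQP refuted AS
TYPED ⇒ model convention, re-type (not a kill). Nothing here refutes S.
NOT DECOMPOSED YET. Approx-QFT_p / eigenstate |χ⟩ / Schoof √−3 / exact-decision wrap (split of crux
2 only once claimed; KsLowerClassesMemBQP then follows from the same children); the reduction
KsEquidistributed → KsNotFrobenianR (elementary, anyone idle); the p-adic face (third-factorial
residuacity ∈ BQP?) and KS vs PH (no item); quantitative exponents (HBP 30/31-type) — irrelevant to
the cruxes; ℓ growing with p; any reduction of W from a standard assumption (none known; vDS §8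
second question "which problems reduce to Gauss sum estimation that do not reduce to factoring or
DLOG" is not an item).
CHEAPEST FALSIFIER. A table hunt (one kit job, minutes): Kummer's class for every p ≡ 1 (3) below
10^6 (class = which root of x³ − 3px − Ap is G_p, A from 4p = A² + 27B², A ≡ 1 (3); O(√p) per prime)
against the data (p mod m, m ≤ 360; #roots mod p of every nonzero f of degree ≤ 4 with coefficients
in [−3, 3]): any cell with ≥ 200 primes and class-I frequency outside [0.23, 0.44] exhibits a
Frobenian pattern, i.e. a candidate CRT/Chebotarev table deciding KS — that kills KsNotFrobenianR,
puts KS (and, run per class, the trit) in P and closes the route refuted:KsThesis. (Kummer's and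
HBP's tables show only the 1:1:1 drift with the DunnRadziwill2024 bias, which is o(1); the refuter
scan of 2026-08-15 to 6·10⁴ found 0 pure cells.) Second cheapest: a literature hit for a poly(log p)
classical evaluation of the cubic Gauss-sum sector (vanDamSeroussi2002 §8 reports none; the frontier
search of 2026-08-15 found none).
DEGENERATE CASES CHECKED. KsNotFrobenianR: m = 0 excluded (0 < m; p % 0 = p would determine p); zero
polynomial excluded (∀ f ∈ fs, f ≠ 0 — the witness that refuted KsNotFrobenian); p | content(f): f ≡
0 mod p for finitely many p only, absorbed by N; constant f ≠ 0: root count eventually 0; for p >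
max |coefficients| every root count is ≤ natDegree f, so the datum ranges over a finite set and D is
a genuine finite table; fs = []: "class I is not eventually determined by p mod m alone" needs class
I and its complement infinite in every class p ≡ 1 (3) ∩ (a mod m) containing infinitely many primes
(HeathBrownPatterson1979-type equidistribution with congruence conditions) — the floor deliverable.
KsThesis/KsMemBQP/KsClassical/KsLowerClassesMemBQP/vanDamSeroussi2002: the set-builders compare G_p
= Σ_{x<p} cos(2πx³/p) with ±Real.sqrt p by strict inequalities; equality G_p = ±√p is impossible
(G_p is a root of x³ − 3px − Ap with A ≡ 1 (3), ±√p is not), and |G_p| < 2√p, so L_I, L_II, L_III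
partition the primes p ≡ 1 (3) exactly as Kummer's three intervals (the three roots 2√p·cos((φ +
2πj)/3), cos φ = A/(2√p), fall one in each interval); W mentions L_I with the verbatim set-builder
of KsThesis/KsMemBQP, so closes is pure logic with no rewriting; W deliberately avoids
Literature.NumberTheory.GaussSums.KummerSector (instances ⟨p, r, k⟩ with r a primitive root:
deciding it classically entails primitive-root recognition, a factoring-type side door vDS's proviso
excludes). Direct summation over the 45 primes p ≡ 1 (3) below 500 reproduces Kummer's count 24 : 14
: 7 for (√p,2√p) : (−√p,√p) : (−2√p,−√p) (IrelandRosen1990 §9.12, pp. 137–138 of the held 1982 ed.),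
e.g. p = 7, 31, 43 are class I and 13, 19, 37, 61 are not.

Novelty: NOVELTY (searched BEFORE claiming, 2026-08-15; plus the card's audit
refuter-novelty-audit-QuantumAdvantage-QuantumAdvantage-2-0 of 04:25Z).
Searches this session: `lit frontier QuantumAdvantage --since 2020` (30 descendants; only relevant:
arXiv:2602.17647 AaronsonGurLi2026, pseudo-
deterministic quantum algorithms, QUERY model); `lit bridges QuantumAdvantage --cross any` (generic
P-vs-NP surveys; no number-theory bridge);
zbMATH "cubic Gauss sums prime arguments" (8: HeathBrownPatterson1979 zbl:0412.10028, Patterson1987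
doi:10.1112/plms/s3-54.2.193 + Göttingen preprint
zbl:0579.10015, Loxton 1978 doi:10.1515/crll.1978.297.153, Garaev 2000 zbl:1050.11072, Haessig
2009); zbMATH "Frobenian ... cubic Gauss sum Kummer"
(0); crossref "Gauss factorials class number Mordell Chowla" (CosgraveDilcher2011 et seq.); local
hybrid "cubic Gauss sums prime arguments
equidistribution Hecke" (IrelandRosen held: read p0123 §9.4 Lemma 1 + Cor g³ = pπ, p0137–0138 §9.12
Kummer's problem, HBP, Matthews' quartic formula);
vanDamSeroussi2002 held: read p0005–0008 (Facts 2–4, state |χ⟩, Thm 1, Lemma 2), p0012 (§8 open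
question); `lit galaxy search --star all` and
OpenAlex/S2/arXiv legs: service unavailable / HTTP 429 this session (logged); HBP1979 and
Patterson1987 paywalled → acq-02101, acq-02091.
NEAREST PRIOR ART. (a) vanDamSeroussi2002: the quantum step verbatim (Thm 1: arg G(F_{p^r},χ,β) to
±ε in O(ε⁻¹ polylog)); classical hardness left
OPEN (§8) with evidence only for full-order χ (Lemma 2, DL  [refs: 10.1112/plms/s3-54.2.193, 10.1515/crll.1978.297.153, 2602.17647, doi:10.1112/plms/s3-54.2.193, doi:10.1515/crll.1978.297.153, AaronsonGurLi2026, HeathBrownPatterson1979, Patterson1987, CosgraveDilcher2011, IrelandRosen1990, Matthews1979]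

Barriers (technique_class: conditional-bridge, quantum-algorithm, number-theory): Literature.Barriers.QuantumAdvantage.SeparationPrerequisites: NOT evaded — applies in full to X:
KsMemBQP ∧ X ⇒ S ⇒ PP ⊄ BPP, P ≠ PP, P ≠ PSPACE (of_facts); X is the declared hypothesis of this
CONDITIONAL BRIDGE (target, never staffed for proof; its negation KsClassical is staffed).
Literature.Barriers.QuantumAdvantage.Relativization: NOT evaded for X — KS ∈ PSPACE (sum p cosines
to n bits in poly space), so "KS ∉ BPP" has no proof relativizing w.r.t. a PSPACE-complete oracle;
the bridge half (KS ∈ BQP, an inclusion proved by an explicit oracle-free family) relativizes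
harmlessly, as for route Shor.
Literature.Barriers.QuantumAdvantage.Algebrization: same status as Relativization
(not_isAlgebrizingSeparation_bqp_bpp): an algebrizing proof of X composed with KsMemBQP would
algebrize BQP ⊄ BPP; X is a hypothesis.
Literature.Barriers.QuantumAdvantage.NaturalProofs: n/a — uniform classes only, no circuit lower
bound is claimed (no_naturalProof_bqp_not_ppoly concerns BQP ⊄ P/poly).
Literature.Barriers.QuantumAdvantage.TotalFunctionSpeedupLimit: n/a but worth stating why, since KS
is TOTAL/promise-free: Beals et al. (D ≤ Q⁶) and the pseudo-deterministic quintic limit of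
AaronsonGurLi2026 are QUERY-model statements about black-box inputs; KS is white-box (input = p) and
the algorithm exploits the additive/multiplicative character duality of F_p, vDS §8's "natural
problem that does not assume a black box". Promise-freeness here costs nothing because the
quantisation is algebraic, no

History (route lifecycle, newest last):
- 2026-08-15T11:25:08Z · BROKEN — KsNotFrobenian (stmt-QuantumAdvantage-1615, crux) refuted by Summit.QuantumAdvantage.QuantumAdvantage.Theorems.KummerSectorKsNotFrobenian_refuted @ 489ebb6d16e0 (refuter-rreview-route-QuantumAdvantage-I-d39967b4-0)
- 2026-08-15T21:20:47Z · rev 4: dropped KsNotFrobenian — repair (clear BROKEN): KsNotFrobenian (stmt-QuantumAdvantage-1615) refuted-MISSTATED by Summit.QuantumAdvantage.QuantumAdvantage.Theorems.KummerSectorKsNotFrobe (planner-rglue-QuantumAdvantage-KummerSector-0620ab48-0)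
- 2026-08-15T21:20:47Z · REPAIRED (drop KsNotFrobenian) — back to open: repair (clear BROKEN): KsNotFrobenian (stmt-QuantumAdvantage-1615) refuted-MISSTATED by Summit.QuantumAdvantage.QuantumAdvantage.Theorems.KummerSectorKsNotFrobe (planner-rglue-QuantumAdvantage-KummerSector-0620ab48-0)
- 2026-08-26T14:17:17Z · DORMANT — reconciler: no traction for 6.7 d (last activity item-proof-filed at 2026-08-19T20:56:38Z); parked, not closed — `ledger route dormant route-QuantumAdvantage-Ku (operator:999:1624582)

sub-problem: QuantumAdvantage · status: dormant · opened planner-plancard-QuantumAdvantage-QuantumAdva-78ce411b-0 2026-08-15T10:57:40Z · rev 10 · ledger route-QuantumAdvantage-KummerSector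
GENERATED by the gate from the ledger (D-0016/17). Provers cite these decls: `theorem foo : Summit.QuantumAdvantage.QuantumAdvantage.Theses.KummerSector.<Decl> := …` in Summits/QuantumAdvantage/QuantumAdvantage/Theorems/<Name>.lean.
-/

namespace Summit.QuantumAdvantage.QuantumAdvantage.Theses.KummerSector

open scoped BigOperators Topology Manifold Classical MeasureTheory ProbabilityTheory Matrix InnerProductSpace ComplexConjugate ContinuousMap
open Filter Set Function TopologicalSpace MeasureTheory

attribute [summit_statement] _root_.QuantumAdvantage
-- H21.Audit: conditional_on 'vanDamSeroussi2002' is not an accepted declaration — no route_premise tag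

open Literature.QuantumAdvantage

/-- item stmt-QuantumAdvantage-1613 · target · rank 0 · open · by planner
why it might fail: Hypothesis-type: vDS §8 p.12 poses classical hardness as OPEN; no reduction from any standard assumption. May be false: a Chowla–Matthews-type unit/class-number formula for the cubic trit, or a cubic reciprocity descent, puts KS in subexp or P. Unprovable outright today (⇒ P ≠ PSPACE).
sources: vanDamSeroussi2002 §8 p.12 (arXiv:quant-ph/0207131; READ p0012 L18-21), vanDamSeroussi2002 Thm 1 p.7 (the quantum side; cubic case = KsMemBQP), IrelandRosen1990 §9.12 pp.137-138 (Kummer's problem), §9.4 Cor. p.123 (g³ = pπ), HeathBrownPatterson1979, Matthews1979, Literature.Barriers.QuantumAdvantage.SeparationPrerequisites (KS ∉ BPP with KS ∈ BQP ⊆ PSPACE forces P ≠ PSPACE)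
Thesis X of route KummerSector (hypothesis-type target of a CONDITIONAL BRIDGE; not expected to be
proved — its negation KsClassical is the staffed kill). KS = Kummer's class I = {p ≡ 1 (3) prime :
G_p = Σ_{x<p} cos(2πx³/p) > √p} = {p : the cubic Gauss sum g(χ) is the principal cube root of
p·J(χ,χ)} = {p : G_p is the largest root of x³ − 3px − Ap} [IrelandRosen1990 §9.12 pp.137–8; §9.4
Cor. p.123]. Claim: KS ∉ BPP (Arora–Barak random-string BPP of the tree). Classical status: Kummer
1846 (tables), Cassels1970/Matthews1979 (elliptic product with (p−1)/3 factors),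
HeathBrownPatterson1979/Patterson1987 (equidistribution 1:1:1), DunnRadziwill2024 (bias X^{5/6}); no
per-prime algorithm polynomial in log p is known; vanDamSeroussi2002 §8 p.12: 'important open
question if Gauss sum estimation is hard classically, even under the assumption that factoring and
discrete logarithms are easy'. -/
@[route_item "route-QuantumAdvantage-KummerSector"]
def KsThesis : Prop :=
  Computability.encodingNatBool.toLanguage {p : ℕ | p.Prime ∧ p % 3 = 1 ∧ Real.sqrt (p : ℝ) < ∑ x ∈ Finset.range p, Real.cos (2 * Real.pi * (x : ℝ) ^ 3 / (p : ℝ))} ∉ Literature.Computability.Complexity.BPP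

/-- item stmt-QuantumAdvantage-1614 · crux · rank 2 · open · by planner
why it might fail: Mathematically safe (vDS Thm 1 + g³ = p·J(χ,χ) + Schoof's deterministic √−3 mod p); may fail AS TYPED: tree BQP = P-uniform oracle-free Clifford+T with one-wire measurement — needs a uniform APPROXIMATE finite Fourier transform F_p with proved operator-norm error, absent from the Shor chain.
sources: vanDamSeroussi2002, IrelandRosen1990, Schoof1985, Kitaev1995, HalesHallgren2000
THE NEEDED FACT (no van Dam–Seroussi fact exists in Literature; filed as the first crux per D-0019).
KS ∈ BQP. Algorithm on input w: (0) reject non-codewords; decode p; AKS/Literature PRIMES ∈ P and p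
% 3 = 1 else reject. (1) r := √−3 mod p deterministically (Schoof1985, fixed d = −3) → primitive
cube root of unity r₀ = (−1+r)/2; π := gcd(p, r₀ − ω) in ℤ[ω] (Euclid), normalised primary; χ := χ_π
with χ(x) = ω^k iff x^{(p−1)/3} ≡ r₀^k (mod p) — classical modular exponentiation, NO discrete log
(vDS p.6 prepare |χ⟩ via Shor-DLOG for general χ; unnecessary at fixed order). (2) Candidates θ_k :=
arg(π)/3 + 2πk/3 known to any poly number of bits. (3) Quantum (vanDamSeroussi2002 §4, Thm 1 p.7):
prepare |χ⟩ = (p−1)^{-1/2} Σ_{x≠0} χ(x)|x⟩ (uniform superposition + phase kickback of k(x) ∈ ℤ/3),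
apply F_p then |y⟩ ↦ χ²(y)|y⟩: |χ⟩ is an eigenvector with eigenvalue g(χ)/√p = e^{iθ}; O(1) Hadamard
tests (axes 0, π/2) estimate θ to ±π/4 with error prob ≤ 1/10 after O(1) repetitions folded into the
family. (4) Accept iff the nearest candidate is θ_0 (⇔ cos θ > 1/2 ⇔ G_p > √p; equality impossible).
Reuse in the tree: Kitaev Hadamard-test circuits (Literature/Computability/Cryptography/KitaevPhaseE -/
@[route_item "route-QuantumAdvantage-KummerSector", crux]
def KsMemBQP : Prop :=
  Computability.encodingNatBool.toLanguage {p : ℕ | p.Prime ∧ p % 3 = 1 ∧ Real.sqrt (p : ℝ) < ∑ x ∈ Finset.range p, Real.cos (2 * Real.pi * (x : ℝ) ^ 3 / (p : ℝ))} ∈ Literature.Computability.Cryptography.BQP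

/-- item stmt-QuantumAdvantage-10865 · crux · rank 3 · open · by planner
why it might fail: Open theorem-type claim: needs first moments of g̃ twisted by Hecke and permutation characters over every intermediate field of a Galois K/ℚ(ω) (Patterson1987; scope unconfirmed, acq-02091); even the floor m = 1, fs = [] needs HeathBrownPatterson1979 (KS infinite and co-infinite), far from Mathlib.
sources: HeathBrownPatterson1979, Patterson1987, Serre2012NXp, IrelandRosen1990
[crux] REPAIRED KsNotFrobenian (stmt-QuantumAdvantage-1615, refuted-MISSTATED by
Theorems.KummerSectorKsNotFrobenian_refuted: with fs = [0] the 'root count' of the zero polynomial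
is p itself, so the datum (p % 1, [p]) determines p and D := image of KS describes KS exactly — a
degenerate witness with no algorithmic content; KS ∈ ZPP does NOT follow, the kill criterion is not
triggered). Repair = the refuter's own: side condition ∀ f ∈ fs, f ≠ 0, under which every root count
is eventually ≤ natDegree f (p > all |coefficients|) and the datum takes finitely many values for p
≥ N. Statement: for every modulus m ≥ 1 and every finite list of NONZERO integer polynomials
f_1..f_r, Kummer's class I = {p ≡ 1 (3) prime : G_p = Σ_{x<p} cos(2πx³/p) > √p} is NOT eventually (p
≥ N) a function of (p mod m, #{x mod p : f_i(x) ≡ 0}_i), i.e. KS is not a rational-Frobenian /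
congruential set of primes (Serre2012NXp §3.3: root counts of fixed f detect Frob_p up to division,
p mod m adds the cyclotomic part). Degenerate cases now excluded: m = 0 (p % 0 = p), the zero
polynomial (root count p), p | content(f) (finitely many p, absorbed by N), constant f ≠ 0 (root
count eventually 0). Floor deliverable: f -/
@[route_item "route-QuantumAdvantage-KummerSector"]
def KsNotFrobenianR : Prop :=
  ∀ (m : ℕ) (fs : List (Polynomial ℤ)), 0 < m → (∀ f ∈ fs, f ≠ 0) → ¬ ∃ (D : Set (ℕ × List ℕ)) (N : ℕ), ∀ p : ℕ, N ≤ p → p.Prime → p % 3 = 1 → (Real.sqrt (p : ℝ) < ∑ x ∈ Finset.range p, Real.cos (2 * Real.pi * (x : ℝ) ^ 3 / (p : ℝ)) ↔ (p % m, fs.map (fun f => ((Finset.range p).filter (fun x => (p : ℤ) ∣ f.eval (x : ℤ))).card)) ∈ D)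

/-- item stmt-QuantumAdvantage-1616 · crux · rank 4 · open · by planner
why it might fail: It is ¬X and expected FALSE: since Kummer 1846 no per-prime method polynomial in log p; Matthews' product has (p−1)/3 factors; complete cubic sums are Fourier-self-dual at the same modulus, so Hiary-type (quadratic) reciprocity descent does not start. Filed so that the kill (vDS §8) is staffed.
sources: vanDamSeroussi2002, Matthews1979, Hiary2011, CosgraveDilcher2011, Cassels1970
THE KILL (negation of the target): KS ∈ BPP, i.e. a classical randomized poly-time algorithm
deciding whether G_p = Σ_{x<p} cos(2πx³/p) exceeds √p (equivalently computing Kummer's trit k ∈ ℤ/3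
with g(χ_π) = ω^k (pπ)^{1/3}, since the candidates are classical). Proving it closes the route
refuted:KsThesis and answers vanDamSeroussi2002 §8 negatively for fixed-order characters. Lines a
prover/refuter should try, cheapest first: (a) CALIBRATION ℓ = 4: Matthews' quartic formula ε =
−β·χ_π(2i)·(2|b|/a), β = ((p−1)/2)! mod π (IrelandRosen1990 p.138) + Chowla/Mordell (Gauss
factorials via h and the fundamental unit of ℚ(√p), CosgraveDilcher2011) ⇒ quartic sign
classical-subexponential and Hallgren-quantum; look for the cubic analogue: a Kronecker-limit /
elliptic-unit evaluation of the Cassels1970–Matthews1979 third-set product by class number and units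
of ℚ(ω, ∛(pπ)) (degree 6) ⇒ KS ≤ unit-group computation (Buchmann: subexp;
Eisenträger–Hallgren–Kitaev–Song: BQP) — this would NOT give BPP but would re-found X on a standard
number-field assumption and should then be recorded by restating the target; (b) an O(p^{1/2+ε})
classical algorithm (baby-step/giant-step or Bostan–Gaudry–Schost shif -/
@[route_item "route-QuantumAdvantage-KummerSector"]
def KsClassical : Prop :=
  Computability.encodingNatBool.toLanguage {p : ℕ | p.Prime ∧ p % 3 = 1 ∧ Real.sqrt (p : ℝ) < ∑ x ∈ Finset.range p, Real.cos (2 * Real.pi * (x : ℝ) ^ 3 / (p : ℝ))} ∈ Literature.Computability.Complexity.BPP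

/-- item stmt-QuantumAdvantage-14587 · crux · rank 5 · open · by planner
why it might fail: Hypothesis-type: vDS §8 poses classical hardness as OPEN; no reduction from any standard assumption; forces P ≠ PSPACE, so unprovable today. May be FALSE: a Chowla–Mordell/Matthews unit–class-number formula or a cubic reciprocity descent would compute Kummer's trit in P/subexp.
sources: vanDamSeroussi2002 §8 p.12 L18-21 (arXiv:quant-ph/0207131, READ), §4 Thm 1 p.7, §5.1 Lemma 2 p.8, IrelandRosen1990 §9.12 pp.137-138 (Kummer's problem, three intervals), §9.4 Cor. p.123 (g³ = pπ), HeathBrownPatterson1979, Matthews1979, Literature.Barriers.QuantumAdvantage.SeparationPrerequisites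
[crux] THE DECLARED CONDITION of this conditional bridge, listed under the route's conditional_on
name (route-choice (a), operator hold bridge-only 2026-08-16T02:41:17Z; D-0027 §2.2: the open end of
a bridge is a listed crux). van Dam–Seroussi 2002 §8 (arXiv:quant-ph/0207131, p.12 L18–21, READ: 'it
remains therefore an important open question if Gauss sum estimation is hard classically, even under
the assumption that factoring and discrete logarithms are easy') in the CUBIC PRIME-FIELD case,
where constant-precision estimation of arg g(χ) IS Kummer's trit (g(χ)³ = p·J(χ,χ), IrelandRosen1990
§9.4 Cor. p.123: three classical candidates 2π/3 apart). Statement (W): Kummer's trit is not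
BPP-computable — NOT all three of Kummer's class languages L_I = {p ≡ 1 (3) prime : G_p > √p} (= KS,
the language of KsThesis/KsMemBQP/KsClassical verbatim), L_II = {−√p < G_p < √p}, L_III = {G_p <
−√p}, G_p = Σ_{x<p} cos(2πx³/p) (Kummer's three intervals, IrelandRosen1990 §9.12 pp.137–138), are
in BPP (Arora–Barak random-string BPP of the tree). Input = p alone — no primitive root or character
datum, hence no factoring/DLOG side door (vDS's proviso is built in; contrast
Literature.NumberTheory.GaussSums -/
@[route_item "route-QuantumAdvantage-KummerSector", crux]
def vanDamSeroussi2002 : Prop :=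
  ¬ (Computability.encodingNatBool.toLanguage {p : ℕ | p.Prime ∧ p % 3 = 1 ∧ Real.sqrt (p : ℝ) < ∑ x ∈ Finset.range p, Real.cos (2 * Real.pi * (x : ℝ) ^ 3 / (p : ℝ))} ∈ Literature.Computability.Complexity.BPP ∧ Computability.encodingNatBool.toLanguage {p : ℕ | p.Prime ∧ p % 3 = 1 ∧ -Real.sqrt (p : ℝ) < ∑ x ∈ Finset.range p, Real.cos (2 * Real.pi * (x : ℝ) ^ 3 / (p : ℝ)) ∧ ∑ x ∈ Finset.range p, Real.cos (2 * Real.pi * (x : ℝ) ^ 3 / (p : ℝ)) < Real.sqrt (p : ℝ)} ∈ Literature.Computability.Complexity.BPP ∧ Computability.encodingNatBool.toLanguage {p : ℕ | p.Prime ∧ p % 3 = 1 ∧ ∑ x ∈ Finset.range p, Real.cos (2 * Real.pi * (x : ℝ) ^ 3 / (p : ℝ)) < -Real.sqrt (p : ℝ)} ∈ Literature.Computability.Complexity.BPP)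

/-- item stmt-QuantumAdvantage-14588 · crux · rank 9 · open · by planner
why it might fail: Mathematically safe (same vDS Thm 1 phase estimation as KsMemBQP, other two windows; class from (sector k, sign arg π)); may fail AS TYPED exactly as KsMemBQP: tree BQP = P-uniform oracle-free Clifford+T, needs a uniform approximate F_p with proved operator-norm error, absent from the tree.
sources: vanDamSeroussi2002 §4 Thm 1 p.7 (arXiv:quant-ph/0207131), IrelandRosen1990 §9.4 Cor. p.123 (g³ = pπ), §9.12 pp.137-138 (three intervals), Schoof1985, Kitaev1995, Literature.Computability.Cryptography.VanDamSeroussi2002_cubicGaussSumPhase_qsolvable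
[support] LOAD-BEARING companion of crux KsMemBQP (route-choice (a), 2026-08-16): Kummer's classes
II and III are in BQP — L_II = {p ≡ 1 (3) prime : −√p < G_p < √p} ∈ BQP and L_III = {p ≡ 1 (3) prime
: G_p < −√p} ∈ BQP, G_p = Σ_{x<p} cos(2πx³/p) = 2 Re g(χ) (tree model: P-uniform oracle-free
Clifford+T family, one-wire measurement, error ≤ 1/3; languages over {0,1} via encodingNatBool,
input = p alone). Same algorithm as KsMemBQP with a different acceptance window: G_p = 2√p cos θ
with θ = arg g(χ_π) ∈ arg(π)/3 + (2π/3)ℤ, π = J(χ,χ) primary and classical (IrelandRosen1990 §9.4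
Lemma 1 + Cor. p.123: g³ = pπ; √−3 mod p by Schoof1985 or Tonelli–Shanks, Euclid in ℤ[ω]); van
Dam–Seroussi phase estimation of the eigenvalue g(χ)/√p of χ²∘F_p on |χ⟩ to ±π/4 (vanDamSeroussi2002
§4 Thm 1, p.7; tree fact
Literature.Computability.Cryptography.VanDamSeroussi2002_cubicGaussSumPhase_qsolvable, t = 12)
identifies the sector k ∈ ℤ/3 (candidates 2π/3 apart), and the class is read off (k, sign arg π):
class I ⇔ k = 0; k = 1: class II ⇔ arg π < 0, else III; k = 2: class II ⇔ arg π > 0, else III (θ =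
arg π/3 + 2πk/3, class II ⇔ |θ| ∈ (π/3, 2π/3)). Boundaries G_p = ±√p never occur (G_p is a root of
x³ − -/
@[route_item "route-QuantumAdvantage-KummerSector", crux]
def KsLowerClassesMemBQP : Prop :=
  Computability.encodingNatBool.toLanguage {p : ℕ | p.Prime ∧ p % 3 = 1 ∧ -Real.sqrt (p : ℝ) < ∑ x ∈ Finset.range p, Real.cos (2 * Real.pi * (x : ℝ) ^ 3 / (p : ℝ)) ∧ ∑ x ∈ Finset.range p, Real.cos (2 * Real.pi * (x : ℝ) ^ 3 / (p : ℝ)) < Real.sqrt (p : ℝ)} ∈ Literature.Computability.Cryptography.BQP ∧ Computability.encodingNatBool.toLanguage {p : ℕ | p.Prime ∧ p % 3 = 1 ∧ ∑ x ∈ Finset.range p, Real.cos (2 * Real.pi * (x : ℝ) ^ 3 / (p : ℝ)) < -Real.sqrt (p : ℝ)} ∈ Literature.Computability.Cryptography.BQP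

/-- item stmt-QuantumAdvantage-1617 · support · rank 9 · open · by planner
sources: HeathBrownPatterson1979, Patterson1987
Quantitative parent of KsNotFrobenian, the form an analytic proof actually delivers: in every
INFINITE Frobenian cell {p ≡ 1 (3) : (p mod m, root counts of f_1..f_r mod p) = c} Kummer's class I
has relative density exactly 1/3 (HeathBrownPatterson1979 is the case m = 1, fs = []: asymptotic
ratio 1:1:1, IrelandRosen1990 p.138). Implies KsNotFrobenian (a cell on which class I were
eventually determined would have density 0 or 1). Unranked for staffing; anyone idle may reduce
KsNotFrobenian to it (elementary) or attack it from named facts once HBP79/Patterson87 are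
transcribed as Literature facts. -/
@[route_item "route-QuantumAdvantage-KummerSector"]
def KsEquidistributed : Prop :=
  ∀ (m : ℕ) (fs : List (Polynomial ℤ)) (c : ℕ × List ℕ), 0 < m → (Set.Infinite {p : ℕ | p.Prime ∧ p % 3 = 1 ∧ (p % m, fs.map (fun f => ((Finset.range p).filter (fun x => (p : ℤ) ∣ f.eval (x : ℤ))).card)) = c}) → Filter.Tendsto (fun X : ℕ => (((Finset.range X).filter (fun p => p.Prime ∧ p % 3 = 1 ∧ (p % m, fs.map (fun f => ((Finset.range p).filter (fun x => (p : ℤ) ∣ f.eval (x : ℤ))).card)) = c ∧ Real.sqrt (p : ℝ) < ∑ x ∈ Finset.range p, Real.cos (2 * Real.pi * (x : ℝ) ^ 3 / (p : ℝ)))).card : ℝ) / (((Finset.range X).filter (fun p => p.Prime ∧ p % 3 = 1 ∧ (p % m, fs.map (fun f => ((Finset.range p).filter (fun x => (p : ℤ) ∣ f.eval (x : ℤ))).card)) = c)).card : ℝ)) Filter.atTop (nhds (1 / 3 : ℝ))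

/-- item stmt-QuantumAdvantage-1618 · support · rank 9 · open · by planner
sources: vanDamSeroussi2002, CosgraveDilcher2011
CERTIFICATE FACE (carried over from the retired companion card kummer-three-faces, c2, per its
triage note): does Kummer's trit have a succinct classical certificate? Open both ways and
informative both ways: YES = a 'reciprocity certificate' for cubic Gauss sums, new arithmetic (and
KS joins FACT in NP ∩ coNP ∩ BQP); NO (unprovable as such) would make KS a natural explicit-language
candidate for BQP ⊄ NP ∩ coNP, hence for BQP ⊄ PH-type questions where the literature has only
oracle/promise candidates. Note KS ∈ P^{#P} trivially, while membership in PH is unclear (G_p is a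
GapP-type quantity of size ~√p against p terms: Stockmeyer approximate counting does not obviously
decide its sign). Unranked; not load-bearing for the Assembly. -/
@[route_item "route-QuantumAdvantage-KummerSector"]
def KsCertificate : Prop :=
  Computability.encodingNatBool.toLanguage {p : ℕ | p.Prime ∧ p % 3 = 1 ∧ Real.sqrt (p : ℝ) < ∑ x ∈ Finset.range p, Real.cos (2 * Real.pi * (x : ℝ) ^ 3 / (p : ℝ))} ∈ Literature.Computability.Complexity.Nondeterministic.NP ∩ Literature.Computability.Complexity.coNP

/-- item stmt-QuantumAdvantage-1619 · support · rank 9 · open · by planner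
sources: vanDamSeroussi2002, IrelandRosen1990
THE ℓ-LADDER (generalisation K4 of the card): for every prime ℓ, the LARGEST-GAUSSIAN-PERIOD
language {p ≡ 1 (ℓ) : η_0 = Σ_{x ∈ (F_p^×)^ℓ} e(x/p) is (weakly) the largest of the ℓ Gaussian
periods} is in BQP (Σ_{x≠0} e(t x^ℓ/p) = ℓ·η_{ind t}; periods are real for odd ℓ). ℓ = 2: all odd
primes (Gauss's sign theorem g = +√p, +i√p — the Frobenian, classical rung); ℓ = 3: exactly KS (η_0
largest ⇔ G_p = 1 + 3η_0 > √p). Why true for fixed ℓ: g(χ)^a = g(χ^a)·Π_{i<a} J(χ,χ^i) leaves ONE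
unknown ℓ-th root of unity; the Jacobi sums J ∈ ℤ[ζ_ℓ] are classical for fixed ℓ (Stickelberger
factorisation of (J); J is a shortest vector of that ideal lattice in fixed dimension ℓ−1 since all
|σJ|² = p; root of unity fixed by J ≡ −1 mod (1−ζ_ℓ)²); phase estimation to ±π/ℓ picks the root;
then all periods are known algebraic reals and comparisons cost poly bits (Liouville). Cost and
formal size grow with ℓ; ℓ growing with p is deliberately NOT claimed (Jacobi sums and 1/ℓ-precision
both degrade). Unranked. -/
@[route_item "route-QuantumAdvantage-KummerSector"]
def KsEllLadder : Prop :=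
  ∀ ℓ : ℕ, ℓ.Prime → Computability.encodingNatBool.toLanguage {p : ℕ | p.Prime ∧ p % ℓ = 1 ∧ ∀ t : ℕ, 0 < t → t < p → (∑ x ∈ (Finset.range p).filter (fun x => 0 < x), Real.cos (2 * Real.pi * ((t * x ^ ℓ) % p : ℕ) / (p : ℝ))) ≤ ∑ x ∈ (Finset.range p).filter (fun x => 0 < x), Real.cos (2 * Real.pi * ((x ^ ℓ) % p : ℕ) / (p : ℝ))} ∈ Literature.Computability.Cryptography.BQP

/-- item stmt-QuantumAdvantage-1620 · assembly · rank 1 · closed · proved by Summit.QuantumAdvantage.QuantumAdvantage.Theorems.KummerSector.Assembly_proof @ 225e34940813 (prover) · by planner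
sources: vanDamSeroussi2002, BernsteinVazirani1997
One line: a language in BQP (KsMemBQP) and not in BPP (KsThesis = X) witnesses ∃ L ∈ BQP, L ∉ BPP =
Literature.QuantumAdvantage.BQPNotSubsetBPP = QuantumAdvantage; in the sketch `fun h1 h2 => ⟨_, h1,
h2⟩` closes it. Conditional bridge: all content is in KsMemBQP (earned) and X (hypothesis). -/
@[route_item "route-QuantumAdvantage-KummerSector"]
def Assembly : Prop :=
  KsMemBQP → KsThesis → QuantumAdvantage

-- `Assembly` holds: proved by `Summit.QuantumAdvantage.QuantumAdvantage.Theorems.KummerSector.Assembly_proof` @ 225e34940813 (its module imports this route file, so no `_holds` link can be stated here).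

-- records of items no longer active in this route (dropped / restated):
-- earlier KsNotFrobenian (stmt-QuantumAdvantage-1615, dropped 2026-08-15T21:20:47Z): refuted by Summit.QuantumAdvantage.QuantumAdvantage.Theorems.KummerSectorKsNotFrobenian_refuted @ 489ebb6d16e0 — ∀ (m : ℕ) (fs : List (Polynomial ℤ)), 0 < m → ¬ ∃ (D : Set (ℕ × List ℕ)) (N : ℕ), ∀ p : ℕ, N ≤ p → p.Prime → p % 3 = 1 → (Real.sqrt (p : ℝ) < ∑ x ∈ Finset.range p, Real.cos (2 * Real.pi * (x : ℝ) ^ 3 / (p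

/-! D-0027 §2.1 — DECIDING THEOREM (planner-authored via `route open/edit --closes-file`; by planner-rchoice-QuantumAdvantage-KummerSector--4fba8334-g2-0 2026-08-16T03:56:35Z):
its hypotheses are this route's items and its conclusion the sub-problem Statement (glue_lint), and it elaborates with this file. -/

@[closes "route-QuantumAdvantage-KummerSector"] theorem closes (h₁ : KsMemBQP) (h₂ : KsLowerClassesMemBQP) (h₃ : vanDamSeroussi2002) :
    _root_.QuantumAdvantage := by
  -- Pure logic (D-0027 §2.1). ¬Statement says every BQP language is in BPP; KsMemBQP and
  -- KsLowerClassesMemBQP put Kummer's three class languages L_I, L_II, L_III in BQP, hence in BPP,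
  -- which is exactly what the bridge condition vanDamSeroussi2002 (Kummer's trit is not
  -- BPP-computable: not all three class languages are in BPP) denies.
  by_contra hS
  exact h₃ ⟨Classical.by_contradiction fun h => hS ⟨_, h₁, h⟩,
    Classical.by_contradiction fun h => hS ⟨_, h₂.1, h⟩,
    Classical.by_contradiction fun h => hS ⟨_, h₂.2, h⟩⟩

end Summit.QuantumAdvantage.QuantumAdvantage.Theses.KummerSector
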